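import Mathlib
import HarnessLib
import Literature.MathematicalPhysics.QuantumFieldTheory.ConstructiveQFTWave0
import Literature.MathematicalPhysics.QuantumLattice.GaugeGroups
import Literature.MathematicalPhysics.QuantumFieldTheory.Balaban1983to89.B10
import Literature.MathematicalPhysics.QuantumFieldTheory.Balaban1983to89.B10Eq11Trace
import Literature.MathematicalPhysics.QuantumFieldTheory.Balaban1983to89.B10Ineq3Terminal
import Literature.MathematicalPhysics.QuantumFieldTheory.Balaban1983to89.B10Eq6PartitionLower
import Literature.MathematicalPhysics.QuantumFieldTheory.Balaban1983to89.UnitaryModel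

/-!
# `Balaban1983to89.B10Eq5RegularAction` — [Balaban1985UV3] p. 256, the REGULAR-FIELD ACTION INPUT behind
# «(5) ⇒ (3) with a constant O(1) depending on g and ε₀ only … The constant O(1) goes to ∞ as g → 0»:
# `A^η(U_K(U)) ≤ a·|T₁^{(K)}|` on the domain (4), with `a` INDEPENDENT OF ε, from the plaquette regularity of the
# minimal configuration, the upper direction of (11) and the plaquette count of the torus

statement-level skeleton of published theorems with citation tags; proofs where landed; nothing here is a claim about the Yang–Mills mass gap

T. Bałaban, *Ultraviolet stability of three-dimensional lattice pure gauge field theories*, Commun. Math. Phys. **102**,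
255–275 (1985) [Balaban1985UV3] (journal page = PDF page + 254).  PDF held: `paper:balaban1985-cmp102-uv-stability-3d`;
page render read as an image: `pub-balaban/b2b-balaban-ref1/pages/1985-cmp102-uv-stability-3d/…-p002-x2.png` (p. 256).
Cell `lit-balaban` (HOME `run/shared/lean/pub/lit-balaban/`), unit `lit-balaban-r07` gen 12 (B10 reader/fold owner),
SKELETON rows **B10.Eq3**, **B10.Eq5**, **B10.Eq6**, **B10.Eq11** (and the depends-on edge B10.Eq3 → B11.Thm1
«regularity of U_K»).

WHAT IS PRINTED (p. 256 [2], verbatim).  *"χ(U)e^{−O(1)|T_ε|} ≤ ρ_K(U) ≤ e^{O(1)|T_ε|}, |T_ε| = Σ_{x∈T_ε} ε³, (3)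
with a constant O(1) depending on g and ε₀ only. The function χ(U) is a characteristic function of the domain
|U(∂p) − 1| < ε₁, p ⊂ T₁^{(K)}, (4) where ε₁ is a sufficiently small positive constant, which will be chosen later.
The constant O(1) goes to ∞ as g → 0. To get a better bound we have to write explicitly the expression divergent
with g. … χ(U) exp[−(1/g_k²)A^η(U_k(U)) − O(1)|T₁^{(k)}|] ≤ ρ_k(U) ≤ exp O(1)|T₁^{(k)}|, (5) where U_k(U) is the
minimal configuration constructed in [7] and determined by the configuration U on T₁^{(k)}, and satisfying (4),
A^η(U_k(U)) = Σ_{p⊂T_η} η^{−1}[1 − Re tr U_k(U, ∂p)], η = L^{−k}, g_k = g(L^kε)^{1/2},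
|T₁^{(k)}| = Σ_{y∈T₁^{(k)}} 1 = Σ_{x∈T_η} η³ = (L^kε)^{−3}|T_ε|"*; p. 258 [4], (11): *"exp[−(1/g₀²)[1 − Re tr U(∂p)]]
= exp[−(1/2g₀²)|U(∂p) − 1|²]"*; p. 267 [13], (47): *"χ_k … restrictions |U_k(∂p) − 1| < g_kp(g_k)η², p ∈ T_η,
introduced by characteristic functions"*; [7] = [Balaban1985Variational] Theorem 1 p. 279, (8): the minimal orbit
lies in *"𝔘_k({Ω_j}, B₃ε₁)"*.

WHY THIS FILE.  The cell's kernel edges (5)_K ⇒ (3) (`…B10Ineq3Terminal.ineq3_of_bounds5At`, row B10.Eq3) and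
(5)_K ⇒ «ε-uniform lower bound for Z^ε» (`…B10Eq6PartitionLower.partition_lower_of_bounds5`, row B10.Eq6) both carry
the INPUT `hreg : A^η(U_K(U)) ≤ a·|T₁^{(K)}|` on the support of χ — the quantity print calls *"the expression
divergent with g"* once divided by `g_K² = g²ε₀`.  That this input holds WITH `a` INDEPENDENT OF THE LATTICE SPACING ε
(so that (3)'s O(1) depends on `g` and `ε₀` only) is exactly the following printed mechanism, kernel-checked here on
the concrete torus carrier of `…ConstructiveQFTWave0` (`GaugeConfig d L G`, `plaquetteHolonomy`):
(i) the minimal configuration `U_K(U)` of a configuration `U` in the domain (4) is plaquette-regular on the fine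
lattice, `|U_K(U)(∂p′) − 1| ≤ B·ε₁·η²` for every `p′ ⊂ T_η` ([7] Thm 1 (8) / the restrictions χ_K of (47)) — an
INPUT here (hypothesis `hmin` on an arbitrary map `mini : U ↦ U_K(U)`; the minimizer itself is [7]'s, SKELETON row
B11.Thm1, not constructed); (ii) the UPPER direction of (11), `1 − Re tr W ≤ ½|W − 1|²` (normalized trace,
operator norm; PROVED here for `U(N)`, §1 — the cell had only the lower direction `…B10Eq11Trace.eq11_opNorm` and the
normalized-Hilbert–Schmidt identity `eq11_normalized`); (iii) the plaquette count `#{p′ ⊂ T_η} = 3η^{−3}|T₁^{(K)}|`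
(d = 3).  Hence `A^η(U_K(U)) = Σ_{p′} η^{−1}[1 − Re tr U_K(U)(∂p′)] ≤ η^{−1}·½B²ε₁²η⁴·3η^{−3}|T₁^{(K)}| = (3/2)B²ε₁²·|T₁^{(K)}|`:
the factors of η CANCEL, `a = (3/2)B²ε₁²` (generally `3κB²ε₁²` for a deviation gauge with `1 − Re tr ≤ κ|· − 1|²`).

WHAT THIS FILE PROVES (kernel; no `sorry`, no named fact; one definition with body, `fineAction`).
* §1 (11) UPPER DIRECTION for `U(N)`: `sum_sq_entries_le_card_mul_opNorm_sq` (Hilbert–Schmidt ≤ N·operator², any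
  complex matrix), **`one_sub_nReTr_le`** (`1 − N⁻¹Re Tr U ≤ ½‖U − 1‖²_op`, `U ∈ U(N)`), `one_sub_nReTr_le_half_opDist1_sq`
  (the same in the letters of `…UnitaryModel`), `one_sub_reTr_le_unitaryGroup` / `_specialUnitaryGroup` (the same for
  the cell's `GaugeGroup` interface `reTr`/`dist1` on `U(N)`, `SU(N)`).
* §2 THE FINE WILSON ACTION `fineAction η act W = Σ_{p′} η⁻¹·act(W(∂p′))` on `GaugeConfig d L_f G` (print's A^η with
  `act = 1 − Re tr`), `fineAction_nonneg`, the plaquette count `card_plaquette` (`= L^d·#{i<j}`; `= 3L³` in d = 3, the tree's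
  `card_plaquette_three` of `MassGapTransferHC` §17i, recomputed inline), and **`fineAction_le_of_plaq_le`**: `act ≤ κ·dev²` and `dev(W(∂p′)) ≤ δ` for all `p′` ⇒
  `A^η(W) ≤ η⁻¹κδ²·#plaquettes`.
* §3 ε-INDEPENDENCE at `d = 3`: **`fineAction_le_sites`** — on the fine torus of side `L·M` (`η = M⁻¹`, `|T₁^{(K)}| = L³`)
  a configuration with `dev(W(∂p′)) ≤ c·η²` for all `p′` has `A^η(W) ≤ 3κc²·L³`, NO `M` (i.e. no ε, no K) left.
* §4 THE DISCHARGE: `dev_nonneg` (from the deviation axioms of `…B10Eq6PartitionLower`), **`hreg_of_minimizer_regular`**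
  (the hypothesis `hreg` of `partition_lower_of_bounds5` / `ineq3_of_bounds5At` from (i) with `a = 3κ(Bε₁)²`),
  **`partition_lower_of_regularity`** (= `…B10Eq6PartitionLower.partition_lower_of_bounds5` with `hreg` DISCHARGED:
  inputs = (5)_K pointwise, χ = 1 on (4), plaquette regularity of `U_K(U)` on (4)), **`ineq3_of_Bounds5At_regular`**
  (= `…B10Ineq3Terminal.ineq3_of_bounds5At` BY NAME for a run `D : B10.RunData` whose terminal configurations and
  minimizer action are identified with the concrete ones, `hreg` DISCHARGED the same way: (3) with
  `O(1)_lower = ε₀⁻³(O1 + 3κ(Bε₁)²·g_K⁻²)`, `g_K⁻² = (g²ε₀)⁻¹` — *"goes to ∞ as g → 0"*, cf. `ineq3_constant_unbounded`).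
* §5 `G = U(N)`, `SU(N)` (operator norm `devU`/`devSU`, `act = 1 − Re tr`, `κ = ½`): `act_le_half_devU_sq`,
  `act_le_half_devSU_sq`, **`partition_lower_of_regularity_unitaryGroup`** (`a = (3/2)(Bε₁)²`, `#bonds = 3L³`).

* §6 (v1.1, append-only) «χ_K = 1 on (4)» FROM THE SAME REGULARITY: `chi_eq_one_of_minimizer_regular` ((4) ⊂ (47)_K
  given `Bε₁ < g_Kp(g_K)`), `partition_lower_of_regularity47` / `_unitaryGroup` (row B10.Eq6 with BOTH `hχ` and
  `hreg` discharged to [7] Thm 1 (8)), `ineq3_of_Bounds5At_regular_chi4` (row B10.Eq3 with χ_K = χ of (4)).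
* §7 (v1.2, append-only) THE SEMISIMPLE CASE `G = SU(N)` of Theorem 1 (p. 257): `partition_lower_of_regularity_specialUnitaryGroup`,
  `partition_lower_of_regularity47_specialUnitaryGroup`; (11) upper direction for every `GaugeGroup.ofUnitaryRep`
  (`one_sub_reTr_le_ofUnitaryRep`).

HONEST SCOPE.  (a) The minimal configuration `U_K(U)` and its regularity (i) are NOT constructed/proved here — they are
[7] = [Balaban1985Variational] Thm 1 (SKELETON row B11.Thm1, typed `B11.Thm1Printed`); this file turns the cell's
unnamed action input `hreg` into THAT printed regularity statement plus kernel arithmetic, nothing more.  (b) `d = 3`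
only in §3–§5 (the η-cancellation `η⁻¹·η⁴·η⁻³ = 1` is the d = 3 count; for general d the bound of §2 carries
`η^{3−d}`-type factors, cf. `g₀² = g²ε^{4−d}` p. 256).  (c) Deviation gauge abstract in §2–§4 (`dev`, `act`, `κ`);
print's `|·|` = operator norm and `tr` = normalized trace are the §5 instance (`κ = ½` by §1; with the normalized
Hilbert–Schmidt reading of (11), `eq11_normalized`, `κ = ½` with equality).  (d) Nothing of (3)/(5)/(6) is asserted
for the true densities; rows B10.Eq3/B10.Eq6 stay «modulo [7] Thm 1», now modulo its plaquette-regularity clause BY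
SHAPE rather than an action bound.  NOT summit progress.
-/

noncomputable section

namespace Literature.MathematicalPhysics.QuantumFieldTheory.Balaban1983to89.B10Eq5RegularAction

open _root_.MeasureTheory
open B10Eq6PartitionLower (plaqSmall devU devSU)

-- The torus sites of `…ConstructiveQFTWave0` under the alias `WSite` (inside this namespace the bare name `Site`
-- resolves to the `Setup` lattice `Balaban1983to89.Site`, a different carrier).
open _root_.Literature.MathematicalPhysics.QuantumFieldTheory renaming Site → WSite

/-! ## §1 The upper direction of (11) for `U(N)`: `1 − Re tr U ≤ ½|U − 1|²` (normalized trace, operator norm) -/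

section Eleven

open scoped Matrix.Norms.L2Operator
open Matrix

variable {n : Type*} [Fintype n] [DecidableEq n]

/-- Hilbert–Schmidt is dominated by `N` times the operator norm: `Σ_{i,j}|A_{ij}|² ≤ N·‖A‖²_op` for every complex
`N × N` matrix (column `j` of `A` is `A e_j`, `‖A e_j‖ ≤ ‖A‖_op`).  (elementary step towards the upper direction of
(11)) [cite: Balaban1985UV3, (11) p.258] -/
theorem sum_sq_entries_le_card_mul_opNorm_sq (A : Matrix n n ℂ) :
    ∑ i, ∑ j, ‖A i j‖ ^ 2 ≤ (Fintype.card n : ℝ) * ‖A‖ ^ 2 := by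
  rw [Finset.sum_comm]
  have hcol : ∀ j, ∑ i, ‖A i j‖ ^ 2 ≤ ‖A‖ ^ 2 := by
    intro j
    set x : EuclideanSpace ℂ n := EuclideanSpace.single j (1 : ℂ) with hx
    have hxn : ‖x‖ = 1 := by simp [hx]
    have h1 : ‖toEuclideanCLM (n := n) (𝕜 := ℂ) A x‖ ≤ ‖toEuclideanCLM (n := n) (𝕜 := ℂ) A‖ * ‖x‖ :=
      ContinuousLinearMap.le_opNorm _ _
    rw [hxn, mul_one, ← cstar_norm_def] at h1
    have h2 : ∑ i, ‖A i j‖ ^ 2 = ‖toEuclideanCLM (n := n) (𝕜 := ℂ) A x‖ ^ 2 := by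
      rw [EuclideanSpace.norm_sq_eq]
      refine Finset.sum_congr rfl fun i _ => ?_
      have hi : (toEuclideanCLM (n := n) (𝕜 := ℂ) A x) i = A i j := by
        change (A *ᵥ WithLp.ofLp x) i = A i j
        rw [hx, PiLp.ofLp_single, Matrix.mulVec_single_one]
        rfl
      rw [hi]
    rw [h2]
    exact pow_le_pow_left₀ (norm_nonneg _) h1 2
  calc ∑ j, ∑ i, ‖A i j‖ ^ 2 ≤ ∑ _j : n, ‖A‖ ^ 2 := Finset.sum_le_sum fun j _ => hcol j
    _ = (Fintype.card n : ℝ) * ‖A‖ ^ 2 := by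
        rw [Finset.sum_const, Finset.card_univ, nsmul_eq_mul]

/-- **(11) p. 258, UPPER DIRECTION in the operator-norm reading**: for `U ∈ U(N)`,
`1 − N⁻¹ Re Tr U ≤ ½‖U − 1‖²_op` — the action density of a plaquette variable is at most half the squared operator-norm
deviation (eigenvalues `e^{iθ_l}`: `N⁻¹Σ(1 − cos θ_l) = (2N)⁻¹Σ|e^{iθ_l} − 1|² ≤ ½ max_l|e^{iθ_l} − 1|²`).  Kernel route:
`…B10Eq11Trace.sum_sq_entries_eq` (`Σ|(U − 1)_{ij}|² = 2N(1 − N⁻¹Re Tr U)`) and `sum_sq_entries_le_card_mul_opNorm_sq`.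
Companion of the LOWER direction `…B10Eq11Trace.eq11_opNorm` (`‖U − 1‖²_op ≤ 2N(1 − N⁻¹Re Tr U)`).
[cite: Balaban1985UV3, (11) p.258] -/
theorem one_sub_nReTr_le [Nonempty n] (U : Matrix n n ℂ) (hU : U ∈ Matrix.unitaryGroup n ℂ) :
    1 - (Fintype.card n : ℝ)⁻¹ * U.trace.re ≤ (1 / 2) * ‖U - 1‖ ^ 2 := by
  have hN : (0 : ℝ) < Fintype.card n := Nat.cast_pos.mpr Fintype.card_pos
  have h2 := sum_sq_entries_le_card_mul_opNorm_sq (U - 1)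
  rw [B10Eq11Trace.sum_sq_entries_eq U hU] at h2
  nlinarith [h2, hN, sq_nonneg ‖U - 1‖]

/-- (11) upper direction in the letters of `…UnitaryModel` (`nReTr U = Re Tr U / N`, `opDist1 U = ‖U − 1‖_op`):
`1 − Re tr U ≤ ½|U − 1|²` for `U ∈ U(N)`. [cite: Balaban1985UV3, (11) p.258] -/
theorem one_sub_nReTr_le_half_opDist1_sq [Nonempty n] {U : Matrix n n ℂ} (hU : U ∈ Matrix.unitaryGroup n ℂ) :
    1 - UnitaryModel.nReTr U ≤ (1 / 2) * UnitaryModel.opDist1 U ^ 2 := by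
  have h := one_sub_nReTr_le U hU
  rw [UnitaryModel.nReTr, UnitaryModel.opDist1, div_eq_inv_mul]
  exact h

open Literature.MathematicalPhysics.QuantumLattice in
/-- (11) upper direction for the cell's gauge-group interface on `G = U(N)` (`Setup.GaugeGroup`, instance
`UnitaryModel.instGaugeGroupUnitaryGroup`): `1 − reTr u ≤ ½(dist1 u)²`. [cite: Balaban1985UV3, (11) p.258] -/
theorem one_sub_reTr_le_unitaryGroup [Nonempty n] (u : Matrix.unitaryGroup n ℂ) :
    1 - reTr u ≤ (1 / 2) * dist1 u ^ 2 := by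
  show 1 - UnitaryModel.nReTr (unitaryFundamentalRep n ℂ u) ≤
    (1 / 2) * UnitaryModel.opDist1 (unitaryFundamentalRep n ℂ u) ^ 2
  rw [unitaryFundamentalRep_apply]
  exact one_sub_nReTr_le_half_opDist1_sq u.2

open Literature.MathematicalPhysics.QuantumLattice in
/-- (11) upper direction for the cell's gauge-group interface on `G = SU(N)` (instance
`UnitaryModel.instGaugeGroupSpecialUnitaryGroup`): `1 − reTr u ≤ ½(dist1 u)²`. [cite: Balaban1985UV3, (11) p.258] -/
theorem one_sub_reTr_le_specialUnitaryGroup [Nonempty n] (u : Matrix.specialUnitaryGroup n ℂ) :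
    1 - reTr u ≤ (1 / 2) * dist1 u ^ 2 := by
  show 1 - UnitaryModel.nReTr (fundamentalRep n u) ≤ (1 / 2) * UnitaryModel.opDist1 (fundamentalRep n u) ^ 2
  exact one_sub_nReTr_le_half_opDist1_sq (fundamentalRep_mem_unitaryGroup u)

end Eleven

/-! ## §2 The fine Wilson action `A^η` on the torus carrier and its bound for plaquette-regular configurations -/

section FineAction

variable {d Lf : ℕ} {G : Type*} [Group G]

/-- **The fine-lattice Wilson action of (5)** p. 256: `A^η(W) = Σ_{p′⊂T_η} η^{−1}[1 − Re tr W(∂p′)]` for a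
configuration `W` on the fine torus (`GaugeConfig d L_f G` of `…ConstructiveQFTWave0`, one term per plaquette
`p′ = (x; i < j)`), with the one-plaquette action density abstracted as `act : G → ℝ` (print: `act = 1 − Re tr`,
normalized trace — §5). [cite: Balaban1985UV3, (5) p.256] -/
def fineAction [NeZero Lf] (η : ℝ) (act : G → ℝ) (W : GaugeConfig d Lf G) : ℝ :=
  ∑ p : Plaquette d Lf, η⁻¹ * act (plaquetteHolonomy W p.1 p.2.1.1 p.2.1.2)

/-- Unfolding of `fineAction`. [cite: Balaban1985UV3, (5) p.256] -/
theorem fineAction_def [NeZero Lf] (η : ℝ) (act : G → ℝ) (W : GaugeConfig d Lf G) :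
    fineAction η act W = ∑ p : Plaquette d Lf, η⁻¹ * act (plaquetteHolonomy W p.1 p.2.1.1 p.2.1.2) := rfl

/-- `A^η(W) ≥ 0` when the action density is non-negative (`1 − Re tr ≥ 0` on `U(N)`) and `η > 0`.
[cite: Balaban1985UV3, (5) p.256] -/
theorem fineAction_nonneg [NeZero Lf] {η : ℝ} (hη : 0 < η) {act : G → ℝ} (hact : ∀ g, 0 ≤ act g)
    (W : GaugeConfig d Lf G) : 0 ≤ fineAction η act W :=
  Finset.sum_nonneg fun _ _ => mul_nonneg (inv_nonneg.mpr hη.le) (hact _)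

/-- **The plaquette count of the torus**: `#{p′ ⊂ (ℤ/L_fℤ)^d} = L_f^d · #{(i,j) : i < j}` (`L_f^d` base points times the
number of coordinate planes).  (elementary step: *"|T₁^{(k)}| = Σ 1 = Σ_{x∈T_η} η³"* counts sites; plaquettes per site =
planes) [cite: Balaban1985UV3, (5) p.256] -/
theorem card_plaquette (d Lf : ℕ) [NeZero Lf] :
    Fintype.card (Plaquette d Lf) = Lf ^ d * Fintype.card {p : Fin d × Fin d // p.1 < p.2} := by
  simp [Fintype.card_prod, Fintype.card_pi, ZMod.card, Finset.prod_const, Fintype.card_fin]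

-- `d = 3`: three coordinate planes, `#{p′ ⊂ (ℤ/L_fℤ)³} = 3·L_f³` — already in the tree as
-- `Literature.MathematicalPhysics.QuantumFieldTheory.card_lt_pairs_fin_three` / `card_plaquette_three`
-- (`Balaban1983to89/MassGapTransferHC.lean` §17i); recomputed inline below by `decide` to keep the import cone small.

/-- **Regular configurations have small action, plaquette by plaquette**: if the action density is dominated by the
squared deviation, `act(g) ≤ κ·dev(g)²` (print: (11), `κ = ½`), and every plaquette variable of `W` deviates from `1` by
at most `δ`, then `A^η(W) ≤ η^{−1}·κδ²·#{p′ ⊂ T_η}`. [cite: Balaban1985UV3, (5) p.256, (11) p.258] -/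
theorem fineAction_le_of_plaq_le [NeZero Lf] {η κ δ : ℝ} (hη : 0 < η) (hκ : 0 ≤ κ) {act dev : G → ℝ}
    (hact : ∀ g, act g ≤ κ * dev g ^ 2) (hdev : ∀ g, 0 ≤ dev g) {W : GaugeConfig d Lf G}
    (hW : ∀ (x : WSite d Lf) (i j : Fin d), dev (plaquetteHolonomy W x i j) ≤ δ) :
    fineAction η act W ≤ η⁻¹ * (κ * δ ^ 2) * Fintype.card (Plaquette d Lf) := by
  have hterm : ∀ p : Plaquette d Lf,
      η⁻¹ * act (plaquetteHolonomy W p.1 p.2.1.1 p.2.1.2) ≤ η⁻¹ * (κ * δ ^ 2) := by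
    intro p
    refine mul_le_mul_of_nonneg_left ((hact _).trans ?_) (inv_nonneg.mpr hη.le)
    exact mul_le_mul_of_nonneg_left (pow_le_pow_left₀ (hdev _) (hW _ _ _) 2) hκ
  calc fineAction η act W ≤ ∑ _p : Plaquette d Lf, η⁻¹ * (κ * δ ^ 2) := Finset.sum_le_sum fun p _ => hterm p
    _ = η⁻¹ * (κ * δ ^ 2) * Fintype.card (Plaquette d Lf) := by
        rw [Finset.sum_const, Finset.card_univ, nsmul_eq_mul, mul_comm]

end FineAction

/-! ## §3 ε-independence in `d = 3`: the factors of `η` cancel -/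

section Three

variable {G : Type*} [Group G]

/-- **`A^η(W) ≤ 3κc²·|T₁^{(K)}|`, uniformly in η** (p. 256: (3) holds *"with a constant O(1) depending on g and ε₀
only"*): on the fine torus `T_η` of side `L·M` (`η = M⁻¹ = L₀^{−K}`, unit torus `T₁^{(K)}` of side `L`, `|T₁^{(K)}| = L³`)
a configuration whose plaquette variables satisfy `dev(W(∂p′)) ≤ c·η²` for all `p′` (the regularity of the minimal
configurations, [7] Thm 1 (8) / (47)) has `A^η(W) = Σ η^{−1}act(W(∂p′)) ≤ η^{−1}·κc²η⁴·3η^{−3}L³ = 3κc²·L³`.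
[cite: Balaban1985UV3, (3)–(5) p.256] -/
theorem fineAction_le_sites {L M Lf : ℕ} [NeZero Lf] (hLf : Lf = L * M) (hM : 0 < M) {κ c : ℝ} (hκ : 0 ≤ κ)
    {act dev : G → ℝ} (hact : ∀ g, act g ≤ κ * dev g ^ 2) (hdev : ∀ g, 0 ≤ dev g)
    {W : GaugeConfig 3 Lf G}
    (hW : ∀ (x : WSite 3 Lf) (i j : Fin 3), dev (plaquetteHolonomy W x i j) ≤ c * ((M : ℝ)⁻¹) ^ 2) :
    fineAction (M : ℝ)⁻¹ act W ≤ 3 * κ * c ^ 2 * (L : ℝ) ^ 3 := by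
  have hMpos : (0 : ℝ) < M := Nat.cast_pos.mpr hM
  have h := fineAction_le_of_plaq_le (inv_pos.mpr hMpos) hκ hact hdev hW
  have h3 : Fintype.card {p : Fin 3 × Fin 3 // p.1 < p.2} = 3 := by decide
  have hc : (Fintype.card (Plaquette 3 Lf) : ℝ) = 3 * ((L : ℝ) * M) ^ 3 := by
    rw [card_plaquette, h3, hLf]; push_cast; ring
  rw [hc] at h
  have hM' : (M : ℝ) ≠ 0 := hMpos.ne'
  calc fineAction (M : ℝ)⁻¹ act W
      ≤ ((M : ℝ)⁻¹)⁻¹ * (κ * (c * ((M : ℝ)⁻¹) ^ 2) ^ 2) * (3 * ((L : ℝ) * M) ^ 3) := h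
    _ = 3 * κ * c ^ 2 * (L : ℝ) ^ 3 := by
        field_simp

end Three

/-! ## §4 The discharge of `hreg` in rows B10.Eq3 / B10.Eq6 -/

section Discharge

variable {G : Type*} [Group G]

/-- A deviation gauge with `dev(1) = 0`, `dev(ab) ≤ dev a + dev b`, `dev(a⁻¹) ≤ dev a` (the three axioms used in
`…B10Eq6PartitionLower`) is non-negative: `0 = dev(aa⁻¹) ≤ dev a + dev a⁻¹ ≤ 2 dev a`. (elementary step)
[cite: Balaban1985UV3, (4) p.256] -/
theorem dev_nonneg {dev : G → ℝ} (hmul : ∀ a b : G, dev (a * b) ≤ dev a + dev b)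
    (hinv : ∀ a : G, dev a⁻¹ ≤ dev a) (h1 : dev 1 = 0) (a : G) : 0 ≤ dev a := by
  have h := hmul a a⁻¹
  rw [mul_inv_cancel, h1] at h
  linarith [hinv a]

/-- **The input `hreg` of `…B10Eq6PartitionLower.partition_lower_of_bounds5` / `…B10Ineq3Terminal.ineq3_of_bounds5At`
FROM THE PLAQUETTE REGULARITY OF THE MINIMAL CONFIGURATION** (d = 3): if `U ↦ U_K(U)` (any map `mini` from the unit
torus `T₁^{(K)}` of side `L` to the fine torus of side `L·M`, `η = M⁻¹`) takes the domain (4) into configurations with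
`dev(U_K(U)(∂p′)) ≤ B·ε₁·η²` for every fine plaquette ([7] Thm 1 (8): the minimal orbit lies in `𝔘_K(B₃ε₁)`), and
`act ≤ κ·dev²` ((11)), then `A^η(U_K(U)) ≤ 3κ(Bε₁)²·|T₁^{(K)}|` on (4) — with NO dependence on η, i.e. on ε or K.
[cite: Balaban1985UV3, (3)–(5) p.256; Balaban1985Variational, Thm 1 (8) p.279] -/
theorem hreg_of_minimizer_regular {L M Lf : ℕ} [NeZero Lf] (hLf : Lf = L * M) (hM : 0 < M) {κ B ε₁ : ℝ}
    (hκ : 0 ≤ κ) {act dev : G → ℝ} (hact : ∀ g, act g ≤ κ * dev g ^ 2) (hdev : ∀ g, 0 ≤ dev g)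
    (mini : GaugeConfig 3 L G → GaugeConfig 3 Lf G)
    (hmin : ∀ U ∈ plaqSmall (d := 3) (L := L) dev ε₁,
      ∀ (x : WSite 3 Lf) (i j : Fin 3), dev (plaquetteHolonomy (mini U) x i j) ≤ B * ε₁ * ((M : ℝ)⁻¹) ^ 2) :
    ∀ U ∈ plaqSmall (d := 3) (L := L) dev ε₁,
      fineAction (M : ℝ)⁻¹ act (mini U) ≤ (3 * κ * (B * ε₁) ^ 2) * (L : ℝ) ^ 3 :=
  fun U hU => fineAction_le_sites hLf hM hκ hact hdev (hmin U hU)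

variable {L M Lf : ℕ} [NeZero L] [NeZero Lf] [TopologicalSpace G] [IsTopologicalGroup G] [CompactSpace G]
  [MeasurableSpace G] [BorelSpace G]

/-- **Row B10.Eq6, lower half, with `hreg` DISCHARGED** (pp. 256–257): `…B10Eq6PartitionLower.partition_lower_of_bounds5`
whose action input is replaced by the plaquette regularity of `U_K(U)` on the domain (4).  Inputs: the deviation
axioms, `act ≤ κ·dev²` ((11)), the lower bound of (5) at `k = K` pointwise with `A = A^η ∘ U_K`, `|T₁^{(K)}| = L³`,
`χ = 1` on (4), and `U_K(U) ∈ 𝔘_K(Bε₁)` for `U` in (4) ([7] Thm 1 (8)).  Output: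
`exp(−(O1 + 3κ(Bε₁)²·g_K⁻²)·L³)·m^{#bonds} ≤ ∫dUρ_K`, `m = Haar{dev < ε₁/4} > 0` — every constant ε-free.
[cite: Balaban1985UV3, (5) p.256, (6) p.257; Balaban1985Variational, Thm 1 (8) p.279] -/
theorem partition_lower_of_regularity (hLf : Lf = L * M) (hM : 0 < M) {dev act : G → ℝ}
    (hdevc : Continuous dev) (hmul : ∀ a b : G, dev (a * b) ≤ dev a + dev b)
    (hinv : ∀ a : G, dev a⁻¹ ≤ dev a) (h1 : dev 1 = 0) {κ : ℝ} (hκ : 0 ≤ κ)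
    (hact : ∀ g, act g ≤ κ * dev g ^ 2) {ε₁ : ℝ} (hε₁ : 0 < ε₁) {B gK O1 : ℝ}
    (mini : GaugeConfig 3 L G → GaugeConfig 3 Lf G) {χ ρK : GaugeConfig 3 L G → ℝ}
    (hχ : ∀ U ∈ plaqSmall (d := 3) (L := L) dev ε₁, χ U = 1)
    (h5 : ∀ U, χ U * Real.exp (-(gK⁻¹ ^ 2 * fineAction (M : ℝ)⁻¹ act (mini U)) - O1 * (L : ℝ) ^ 3) ≤ ρK U)
    (hmin : ∀ U ∈ plaqSmall (d := 3) (L := L) dev ε₁,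
      ∀ (x : WSite 3 Lf) (i j : Fin 3), dev (plaquetteHolonomy (mini U) x i j) ≤ B * ε₁ * ((M : ℝ)⁻¹) ^ 2) :
    0 < haarProbability G {g : G | dev g < ε₁ / 4} ∧
      ENNReal.ofReal (Real.exp (-((O1 + (3 * κ * (B * ε₁) ^ 2) * gK⁻¹ ^ 2) * (L : ℝ) ^ 3))) *
          haarProbability G {g : G | dev g < ε₁ / 4} ^ Fintype.card (Edge 3 L) ≤
        ∫⁻ U, ENNReal.ofReal (ρK U) ∂(Measure.pi fun _ : Edge 3 L => haarProbability G) :=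
  B10Eq6PartitionLower.partition_lower_of_bounds5 hdevc hmul hinv h1 hε₁
    (A := fun U => fineAction (M : ℝ)⁻¹ act (mini U)) (S := (L : ℝ) ^ 3) hχ h5
    (hreg_of_minimizer_regular hLf hM hκ hact (dev_nonneg hmul hinv h1) mini hmin)

omit [NeZero L] [TopologicalSpace G] [IsTopologicalGroup G] [CompactSpace G] [MeasurableSpace G] [BorelSpace G] in
/-- **Row B10.Eq3 — (5)_K ⇒ (3) BY NAME with `hreg` DISCHARGED** (p. 256): for a run `D : B10.RunData` whose terminal
configurations are the concrete unit-torus configurations through a surjection `ι` (the identity when the carriers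
coincide), whose minimizer action `D.wilsonBG D.K` IS `A^η ∘ U_K` and whose χ_K is supported in the domain (4), the
plaquette regularity of `U_K(U)` on (4) ([7] Thm 1 (8)) gives the hypothesis `hreg` of
`…B10Ineq3Terminal.ineq3_of_bounds5At` with `a = 3κ(Bε₁)²`, hence (3):
`χ(U)·exp(−ε₀^{−3}(O1 + 3κ(Bε₁)²·g_K^{−2})·|T_ε|) ≤ ρ_K(U) ≤ exp(ε₀^{−3}·O1·|T_ε|)` — O(1) depends on `g`
(through `g_K = gε₀^{1/2}`, `…B10Ineq3Terminal.ineq3_constant_eq`) and `ε₀`, NOT on ε.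
[cite: Balaban1985UV3, (3)–(5) p.256; Balaban1985Variational, Thm 1 (8) p.279] -/
theorem ineq3_of_Bounds5At_regular (hLf : Lf = L * M) (hM : 0 < M) {dev act : G → ℝ}
    (hmul : ∀ a b : G, dev (a * b) ≤ dev a + dev b) (hinv : ∀ a : G, dev a⁻¹ ≤ dev a) (h1 : dev 1 = 0)
    {κ : ℝ} (hκ : 0 ≤ κ) (hact : ∀ g, act g ≤ κ * dev g ^ 2) {ε₁ B O1 ε₀ Tε : ℝ}
    (mini : GaugeConfig 3 L G → GaugeConfig 3 Lf G)
    (hmin : ∀ U ∈ plaqSmall (d := 3) (L := L) dev ε₁,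
      ∀ (x : WSite 3 Lf) (i j : Fin 3), dev (plaquetteHolonomy (mini U) x i j) ≤ B * ε₁ * ((M : ℝ)⁻¹) ^ 2)
    (D : B10.RunData) (ι : GaugeConfig 3 L G → D.Cfg D.K) (hι : Function.Surjective ι)
    (hBG : ∀ U, D.wilsonBG D.K (ι U) = fineAction (M : ℝ)⁻¹ act (mini U))
    (hsupp : ∀ U, D.χ D.K (ι U) ≠ 0 → U ∈ plaqSmall (d := 3) (L := L) dev ε₁)
    (hχ0 : ∀ V : D.Cfg D.K, 0 ≤ D.χ D.K V) (hsitesL : D.sites D.K = (L : ℝ) ^ 3)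
    (hsites : D.sites D.K = ε₀⁻¹ ^ 3 * Tε) (h5 : B10.Bounds5At D O1 D.K) (V : D.Cfg D.K) :
    D.χ D.K V * Real.exp (-((ε₀⁻¹ ^ 3 * (O1 + (3 * κ * (B * ε₁) ^ 2) * (D.g D.K)⁻¹ ^ 2)) * Tε)) ≤ D.ρ D.K V ∧
      D.ρ D.K V ≤ Real.exp ((ε₀⁻¹ ^ 3 * O1) * Tε) := by
  refine B10Ineq3Terminal.ineq3_of_bounds5At D hsites hχ0 (fun W hW => ?_) h5 V
  obtain ⟨U, rfl⟩ := hι W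
  rw [hBG, hsitesL]
  exact hreg_of_minimizer_regular hLf hM hκ hact (dev_nonneg hmul hinv h1) mini hmin U (hsupp U hW)

end Discharge

/-! ## §5 The paper's groups `G = U(N)`, `SU(N)`: operator-norm deviation, normalized trace, `κ = ½` -/

section Unitary

open scoped Matrix.Norms.L2Operator

variable {n : Type*} [Fintype n] [DecidableEq n] [Nonempty n]

/-- For `G = U(N)`: `1 − Re tr u ≤ ½|u − 1|²` with `|·|` = the operator-norm deviation `devU` of
`…B10Eq6PartitionLower` and `Re tr` the normalized trace `UnitaryModel.nReTr` — (11) p. 258, upper direction,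
`κ = ½`. [cite: Balaban1985UV3, (11) p.258] -/
theorem act_le_half_devU_sq (u : Matrix.unitaryGroup n ℂ) :
    1 - UnitaryModel.nReTr (u : Matrix n n ℂ) ≤ (1 / 2) * devU u ^ 2 :=
  one_sub_nReTr_le_half_opDist1_sq u.2

/-- The same for `G = SU(N)` (`devSU`). [cite: Balaban1985UV3, (11) p.258] -/
theorem act_le_half_devSU_sq (u : Matrix.specialUnitaryGroup n ℂ) :
    1 - UnitaryModel.nReTr (u : Matrix n n ℂ) ≤ (1 / 2) * devSU u ^ 2 :=
  one_sub_nReTr_le_half_opDist1_sq (Literature.MathematicalPhysics.QuantumLattice.fundamentalRep_mem_unitaryGroup u)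

/-- **Row B10.Eq6, lower half, `G = U(N)`, `hreg` DISCHARGED** (pp. 256–257; `dU` = product Haar on the bonds of the
terminal unit torus `(ℤ/Lℤ)³`, `|·|` = operator norm, `A^η` with `1 − Re tr`, normalized trace): from (5)_K pointwise,
`χ = 1` on (4) and the plaquette regularity `|U_K(U)(∂p′) − 1| ≤ Bε₁η²` of the minimal configuration on (4)
([7] Thm 1 (8)), `exp(−(O1 + (3/2)(Bε₁)²·g_K⁻²)·L³)·m^{3L³} ≤ ∫dUρ_K`, `m = Haar{|u − 1| < ε₁/4} > 0`.
[cite: Balaban1985UV3, (5) p.256, (6) p.257; Balaban1985Variational, Thm 1 (8) p.279] -/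
theorem partition_lower_of_regularity_unitaryGroup {L M Lf : ℕ} [NeZero L] [NeZero Lf] (hLf : Lf = L * M)
    (hM : 0 < M) {ε₁ : ℝ} (hε₁ : 0 < ε₁) {B gK O1 : ℝ}
    (mini : GaugeConfig 3 L (Matrix.unitaryGroup n ℂ) → GaugeConfig 3 Lf (Matrix.unitaryGroup n ℂ))
    {χ ρK : GaugeConfig 3 L (Matrix.unitaryGroup n ℂ) → ℝ}
    (hχ : ∀ U ∈ plaqSmall (d := 3) (L := L) devU ε₁, χ U = 1)
    (h5 : ∀ U, χ U * Real.exp (-(gK⁻¹ ^ 2 *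
        fineAction (M : ℝ)⁻¹ (fun u : Matrix.unitaryGroup n ℂ => 1 - UnitaryModel.nReTr (u : Matrix n n ℂ))
          (mini U)) -
          O1 * (L : ℝ) ^ 3) ≤ ρK U)
    (hmin : ∀ U ∈ plaqSmall (d := 3) (L := L) devU ε₁,
      ∀ (x : WSite 3 Lf) (i j : Fin 3), devU (plaquetteHolonomy (mini U) x i j) ≤ B * ε₁ * ((M : ℝ)⁻¹) ^ 2) :
    0 < haarProbability (Matrix.unitaryGroup n ℂ) {u | devU u < ε₁ / 4} ∧
      ENNReal.ofReal (Real.exp (-((O1 + (3 * (1 / 2) * (B * ε₁) ^ 2) * gK⁻¹ ^ 2) * (L : ℝ) ^ 3))) *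
          haarProbability (Matrix.unitaryGroup n ℂ) {u | devU u < ε₁ / 4} ^ (3 * L ^ 3) ≤
        ∫⁻ U, ENNReal.ofReal (ρK U)
          ∂(Measure.pi fun _ : Edge 3 L => haarProbability (Matrix.unitaryGroup n ℂ)) := by
  have h := partition_lower_of_regularity hLf hM B10Eq6PartitionLower.continuous_devU
    B10Eq6PartitionLower.devU_mul_le (fun u => (B10Eq6PartitionLower.devU_inv u).le)
    B10Eq6PartitionLower.devU_one (κ := 1 / 2) (by norm_num) act_le_half_devU_sq hε₁ mini hχ h5 hmin
  have hcard : Fintype.card (Edge 3 L) = 3 * L ^ 3 := by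
    simp [Fintype.card_prod, Fintype.card_pi, ZMod.card, Finset.prod_const, Fintype.card_fin, mul_comm]
  rwa [hcard] at h

/-- The U(N) constant made plain: `3·½·(Bε₁)² = (3/2)(Bε₁)²` — the `a` of (3)'s lower constant
`ε₀^{−3}(O1 + a/(g²ε₀))` (`…B10Ineq3Terminal.ineq3_constant_eq`), a function of `B`, `ε₁` only.
[cite: Balaban1985UV3, (3) p.256] -/
theorem regularAction_constant_unitary (B ε₁ : ℝ) : 3 * (1 / 2) * (B * ε₁) ^ 2 = 3 / 2 * (B * ε₁) ^ 2 := by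
  ring

end Unitary

/-! ## §6 (v1.1, append-only) The clause «χ_K = 1 on the domain (4)» from the same regularity input

The cell identifies the χ of (5) at step `k` with the χ_k of (47) p. 267 [13]: *"χ_k … restrictions
|U_k(∂p) − 1| < g_kp(g_k)η², p ∈ T_η, introduced by characteristic functions"* (reading note of SKELETON rows
B10.Eq4/B10.Eq5).  Under that identification the hypothesis `hχ` of `partition_lower_of_bounds5` /
`partition_lower_of_regularity` — «χ_K = 1 on (4)» — is the inclusion (4) ⊂ (47)_K, and it follows from the SAME
plaquette regularity of the minimal configuration ([7] Thm 1 (8): `|U_K(U)(∂p′) − 1| ≤ Bε₁η²` for `U` in (4)) once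
`Bε₁ < g_Kp(g_K)` — print's *"ε₁ is a sufficiently small positive constant, which will be chosen later"* (p. 256;
chosen `ε₁ = g₀p(g₀)` at the first step, (7) p. 257).  So rows B10.Eq3/B10.Eq6 rest on (5)_K, [7] Thm 1 (8) and the
smallness `Bε₁ < g_Kp(g_K)` only.
-/

section Chi47

variable {G : Type*} [Group G]

/-- **(4) ⊂ (47)_K from the regularity of the minimal configuration**: if `χ(U) = 1` whenever every fine plaquette
variable of `U_K(U)` deviates from `1` by less than `g_Kp(g_K)η²` (χ = the characteristic function of the (47)
restrictions, or any function equal to `1` there), if `U_K` takes the domain (4) into `𝔘_K(Bε₁)` ([7] Thm 1 (8)) and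
`Bε₁ < g_Kp(g_K)`, then `χ = 1` on (4). [cite: Balaban1985UV3, (4) p.256, (47) p.267; Balaban1985Variational, Thm 1 (8) p.279] -/
theorem chi_eq_one_of_minimizer_regular {L M Lf : ℕ} (hM : 0 < M) {dev : G → ℝ} {B ε₁ gK pg : ℝ}
    (mini : GaugeConfig 3 L G → GaugeConfig 3 Lf G) {χ : GaugeConfig 3 L G → ℝ}
    (hχ47 : ∀ U, (∀ (x : WSite 3 Lf) (i j : Fin 3),
      dev (plaquetteHolonomy (mini U) x i j) < gK * pg * ((M : ℝ)⁻¹) ^ 2) → χ U = 1)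
    (hmin : ∀ U ∈ plaqSmall (d := 3) (L := L) dev ε₁,
      ∀ (x : WSite 3 Lf) (i j : Fin 3), dev (plaquetteHolonomy (mini U) x i j) ≤ B * ε₁ * ((M : ℝ)⁻¹) ^ 2)
    (hsmall : B * ε₁ < gK * pg) :
    ∀ U ∈ plaqSmall (d := 3) (L := L) dev ε₁, χ U = 1 := by
  intro U hU
  refine hχ47 U fun x i j => (hmin U hU x i j).trans_lt ?_
  have hMpos : (0 : ℝ) < M := Nat.cast_pos.mpr hM
  have hη : (0 : ℝ) < ((M : ℝ)⁻¹) ^ 2 := by positivity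
  exact mul_lt_mul_of_pos_right hsmall hη

variable {L M Lf : ℕ} [NeZero L] [NeZero Lf] [TopologicalSpace G] [IsTopologicalGroup G] [CompactSpace G]
  [MeasurableSpace G] [BorelSpace G]

/-- **Row B10.Eq6, lower half, with BOTH inputs `hχ` and `hreg` discharged to [7] Thm 1 (8)** (pp. 256–257, (47)
p. 267): with χ_K the characteristic function of the (47) restrictions (or any χ equal to `1` there), (5)_K pointwise,
`U_K(U) ∈ 𝔘_K(Bε₁)` for `U` in (4), and `Bε₁ < g_Kp(g_K)`:
`exp(−(O1 + 3κ(Bε₁)²·g_K⁻²)·L³)·m^{#bonds} ≤ ∫dUρ_K`, `m = Haar{dev < ε₁/4} > 0`.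
[cite: Balaban1985UV3, (5) p.256, (6) p.257, (47) p.267; Balaban1985Variational, Thm 1 (8) p.279] -/
theorem partition_lower_of_regularity47 (hLf : Lf = L * M) (hM : 0 < M) {dev act : G → ℝ}
    (hdevc : Continuous dev) (hmul : ∀ a b : G, dev (a * b) ≤ dev a + dev b)
    (hinv : ∀ a : G, dev a⁻¹ ≤ dev a) (h1 : dev 1 = 0) {κ : ℝ} (hκ : 0 ≤ κ)
    (hact : ∀ g, act g ≤ κ * dev g ^ 2) {ε₁ : ℝ} (hε₁ : 0 < ε₁) {B gK pg O1 : ℝ}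
    (mini : GaugeConfig 3 L G → GaugeConfig 3 Lf G) {χ ρK : GaugeConfig 3 L G → ℝ}
    (hχ47 : ∀ U, (∀ (x : WSite 3 Lf) (i j : Fin 3),
      dev (plaquetteHolonomy (mini U) x i j) < gK * pg * ((M : ℝ)⁻¹) ^ 2) → χ U = 1)
    (hsmall : B * ε₁ < gK * pg)
    (h5 : ∀ U, χ U * Real.exp (-(gK⁻¹ ^ 2 * fineAction (M : ℝ)⁻¹ act (mini U)) - O1 * (L : ℝ) ^ 3) ≤ ρK U)
    (hmin : ∀ U ∈ plaqSmall (d := 3) (L := L) dev ε₁,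
      ∀ (x : WSite 3 Lf) (i j : Fin 3), dev (plaquetteHolonomy (mini U) x i j) ≤ B * ε₁ * ((M : ℝ)⁻¹) ^ 2) :
    0 < haarProbability G {g : G | dev g < ε₁ / 4} ∧
      ENNReal.ofReal (Real.exp (-((O1 + (3 * κ * (B * ε₁) ^ 2) * gK⁻¹ ^ 2) * (L : ℝ) ^ 3))) *
          haarProbability G {g : G | dev g < ε₁ / 4} ^ Fintype.card (Edge 3 L) ≤
        ∫⁻ U, ENNReal.ofReal (ρK U) ∂(Measure.pi fun _ : Edge 3 L => haarProbability G) :=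
  partition_lower_of_regularity hLf hM hdevc hmul hinv h1 hκ hact hε₁ mini
    (chi_eq_one_of_minimizer_regular hM mini hχ47 hmin hsmall) h5 hmin

omit [NeZero L] [TopologicalSpace G] [IsTopologicalGroup G] [CompactSpace G] [MeasurableSpace G] [BorelSpace G] in
/-- **Row B10.Eq3 with χ_K = χ of (47) made explicit** (p. 256, (47) p. 267): in `ineq3_of_Bounds5At_regular` the
support hypothesis `hsupp` («χ_K(ιU) ≠ 0 ⇒ U in (4)») is the converse inclusion (47)_K ⊂ (4); when χ_K is EXACTLY
the characteristic function of the domain (4) read on `U` (print's χ of (3)/(5)) it holds by definition, and (3)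
follows from (5)_K, [7] Thm 1 (8) and nothing else: recorded as the special case `χ(ιU) ≠ 0 ↔ U ∈ (4)`.
[cite: Balaban1985UV3, (3)–(5) p.256; Balaban1985Variational, Thm 1 (8) p.279] -/
theorem ineq3_of_Bounds5At_regular_chi4 (hLf : Lf = L * M) (hM : 0 < M) {dev act : G → ℝ}
    (hmul : ∀ a b : G, dev (a * b) ≤ dev a + dev b) (hinv : ∀ a : G, dev a⁻¹ ≤ dev a) (h1 : dev 1 = 0)
    {κ : ℝ} (hκ : 0 ≤ κ) (hact : ∀ g, act g ≤ κ * dev g ^ 2) {ε₁ B O1 ε₀ Tε : ℝ}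
    (mini : GaugeConfig 3 L G → GaugeConfig 3 Lf G)
    (hmin : ∀ U ∈ plaqSmall (d := 3) (L := L) dev ε₁,
      ∀ (x : WSite 3 Lf) (i j : Fin 3), dev (plaquetteHolonomy (mini U) x i j) ≤ B * ε₁ * ((M : ℝ)⁻¹) ^ 2)
    (D : B10.RunData) (ι : GaugeConfig 3 L G → D.Cfg D.K) (hι : Function.Surjective ι)
    (hBG : ∀ U, D.wilsonBG D.K (ι U) = fineAction (M : ℝ)⁻¹ act (mini U))
    (hχ4 : ∀ U, D.χ D.K (ι U) ≠ 0 ↔ U ∈ plaqSmall (d := 3) (L := L) dev ε₁)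
    (hχ0 : ∀ V : D.Cfg D.K, 0 ≤ D.χ D.K V) (hsitesL : D.sites D.K = (L : ℝ) ^ 3)
    (hsites : D.sites D.K = ε₀⁻¹ ^ 3 * Tε) (h5 : B10.Bounds5At D O1 D.K) (V : D.Cfg D.K) :
    D.χ D.K V * Real.exp (-((ε₀⁻¹ ^ 3 * (O1 + (3 * κ * (B * ε₁) ^ 2) * (D.g D.K)⁻¹ ^ 2)) * Tε)) ≤ D.ρ D.K V ∧
      D.ρ D.K V ≤ Real.exp ((ε₀⁻¹ ^ 3 * O1) * Tε) :=
  ineq3_of_Bounds5At_regular hLf hM hmul hinv h1 hκ hact mini hmin D ι hι hBG (fun U h => (hχ4 U).mp h) hχ0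
    hsitesL hsites h5 V

end Chi47

section Chi47Unitary

open scoped Matrix.Norms.L2Operator

variable {n : Type*} [Fintype n] [DecidableEq n] [Nonempty n]

/-- **Row B10.Eq6, lower half, `G = U(N)`, both inputs discharged** (pp. 256–257, (47) p. 267; operator norm, normalized
trace): χ_K = 1 on the (47) restrictions `|U_K(U)(∂p′) − 1| < g_Kp(g_K)η²`, (5)_K pointwise, `U_K(U) ∈ 𝔘_K(Bε₁)` on (4),
`Bε₁ < g_Kp(g_K)` ⇒ `exp(−(O1 + (3/2)(Bε₁)²·g_K⁻²)·L³)·m^{3L³} ≤ ∫dUρ_K`, `m = Haar{|u − 1| < ε₁/4} > 0`.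
[cite: Balaban1985UV3, (5) p.256, (6) p.257, (47) p.267; Balaban1985Variational, Thm 1 (8) p.279] -/
theorem partition_lower_of_regularity47_unitaryGroup {L M Lf : ℕ} [NeZero L] [NeZero Lf] (hLf : Lf = L * M)
    (hM : 0 < M) {ε₁ : ℝ} (hε₁ : 0 < ε₁) {B gK pg O1 : ℝ}
    (mini : GaugeConfig 3 L (Matrix.unitaryGroup n ℂ) → GaugeConfig 3 Lf (Matrix.unitaryGroup n ℂ))
    {χ ρK : GaugeConfig 3 L (Matrix.unitaryGroup n ℂ) → ℝ}
    (hχ47 : ∀ U, (∀ (x : WSite 3 Lf) (i j : Fin 3),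
      devU (plaquetteHolonomy (mini U) x i j) < gK * pg * ((M : ℝ)⁻¹) ^ 2) → χ U = 1)
    (hsmall : B * ε₁ < gK * pg)
    (h5 : ∀ U, χ U * Real.exp (-(gK⁻¹ ^ 2 *
        fineAction (M : ℝ)⁻¹ (fun u : Matrix.unitaryGroup n ℂ => 1 - UnitaryModel.nReTr (u : Matrix n n ℂ))
          (mini U)) -
          O1 * (L : ℝ) ^ 3) ≤ ρK U)
    (hmin : ∀ U ∈ plaqSmall (d := 3) (L := L) devU ε₁,
      ∀ (x : WSite 3 Lf) (i j : Fin 3), devU (plaquetteHolonomy (mini U) x i j) ≤ B * ε₁ * ((M : ℝ)⁻¹) ^ 2) :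
    0 < haarProbability (Matrix.unitaryGroup n ℂ) {u | devU u < ε₁ / 4} ∧
      ENNReal.ofReal (Real.exp (-((O1 + (3 * (1 / 2) * (B * ε₁) ^ 2) * gK⁻¹ ^ 2) * (L : ℝ) ^ 3))) *
          haarProbability (Matrix.unitaryGroup n ℂ) {u | devU u < ε₁ / 4} ^ (3 * L ^ 3) ≤
        ∫⁻ U, ENNReal.ofReal (ρK U)
          ∂(Measure.pi fun _ : Edge 3 L => haarProbability (Matrix.unitaryGroup n ℂ)) :=
  partition_lower_of_regularity_unitaryGroup hLf hM hε₁ mini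
    (chi_eq_one_of_minimizer_regular hM mini hχ47 hmin hsmall) h5 hmin

end Chi47Unitary

/-! ## §7 (v1.2, append-only) The semisimple case of Theorem 1: `G = SU(N)`; and (11) for every `G ⊂ U(N)`

Theorem 1 p. 257 is stated *"with a semi-simple compact group Lie G"*; of the paper's matrix groups `SU(N)` is the
semisimple one (`U(N)` has the `U(1)` centre; semisimplicity is used in print only at (31)⇒(32)).  The U(N) theorems
of §5–§6 are repeated here for `SU(N)` with the operator-norm deviation `devSU` of `…B10Eq6PartitionLower`, and the
upper direction of (11) is recorded for EVERY group carried by a unitary matrix representation (the cell's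
`GaugeGroup.ofUnitaryRep`, [Balaban1985Averaging] p. 20 *"G is a Lie subgroup of U(N)"*).
-/

section SemisimpleCase

open scoped Matrix.Norms.L2Operator

variable {n : Type*} [Fintype n] [DecidableEq n] [Nonempty n]

/-- **(11) upper direction for every group with a unitary matrix representation** (`Setup.GaugeGroup` structure
`GaugeGroup.ofUnitaryRep H ρ hρ`: `dist1 h = ‖ρ h − 1‖_op`, `reTr h = N⁻¹Re Tr ρ h`): `1 − reTr h ≤ ½(dist1 h)²`.
[cite: Balaban1985UV3, (11) p.258] -/
theorem one_sub_reTr_le_ofUnitaryRep {H : Type*} [Group H] (ρ : H →* Matrix n n ℂ)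
    (hρ : ∀ h, ρ h ∈ Matrix.unitaryGroup n ℂ) (h : H) :
    1 - (GaugeGroup.ofUnitaryRep H ρ hρ).reTr h ≤ (1 / 2) * (GaugeGroup.ofUnitaryRep H ρ hρ).dist1 h ^ 2 := by
  rw [GaugeGroup.ofUnitaryRep_reTr, GaugeGroup.ofUnitaryRep_dist1]
  exact one_sub_nReTr_le_half_opDist1_sq (hρ h)

/-- **Row B10.Eq6, lower half, `G = SU(N)` (the semisimple case of Theorem 1), `hreg` DISCHARGED** (pp. 256–257;
`dU` = product Haar on the bonds of `(ℤ/Lℤ)³`, `|·|` = operator norm `devSU`, `A^η` with `1 − Re tr`, normalized trace):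
(5)_K pointwise, `χ = 1` on (4), `|U_K(U)(∂p′) − 1| ≤ Bε₁η²` on (4) ([7] Thm 1 (8)) ⇒
`exp(−(O1 + (3/2)(Bε₁)²·g_K⁻²)·L³)·m^{3L³} ≤ ∫dUρ_K`, `m = Haar_{SU(N)}{|u − 1| < ε₁/4} > 0`.
[cite: Balaban1985UV3, Thm 1 p.257, (5) p.256, (6) p.257; Balaban1985Variational, Thm 1 (8) p.279] -/
theorem partition_lower_of_regularity_specialUnitaryGroup {L M Lf : ℕ} [NeZero L] [NeZero Lf] (hLf : Lf = L * M)
    (hM : 0 < M) {ε₁ : ℝ} (hε₁ : 0 < ε₁) {B gK O1 : ℝ}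
    (mini : GaugeConfig 3 L (Matrix.specialUnitaryGroup n ℂ) → GaugeConfig 3 Lf (Matrix.specialUnitaryGroup n ℂ))
    {χ ρK : GaugeConfig 3 L (Matrix.specialUnitaryGroup n ℂ) → ℝ}
    (hχ : ∀ U ∈ plaqSmall (d := 3) (L := L) devSU ε₁, χ U = 1)
    (h5 : ∀ U, χ U * Real.exp (-(gK⁻¹ ^ 2 *
        fineAction (M : ℝ)⁻¹
          (fun u : Matrix.specialUnitaryGroup n ℂ => 1 - UnitaryModel.nReTr (u : Matrix n n ℂ)) (mini U)) -
          O1 * (L : ℝ) ^ 3) ≤ ρK U)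
    (hmin : ∀ U ∈ plaqSmall (d := 3) (L := L) devSU ε₁,
      ∀ (x : WSite 3 Lf) (i j : Fin 3), devSU (plaquetteHolonomy (mini U) x i j) ≤ B * ε₁ * ((M : ℝ)⁻¹) ^ 2) :
    0 < haarProbability (Matrix.specialUnitaryGroup n ℂ) {u | devSU u < ε₁ / 4} ∧
      ENNReal.ofReal (Real.exp (-((O1 + (3 * (1 / 2) * (B * ε₁) ^ 2) * gK⁻¹ ^ 2) * (L : ℝ) ^ 3))) *
          haarProbability (Matrix.specialUnitaryGroup n ℂ) {u | devSU u < ε₁ / 4} ^ (3 * L ^ 3) ≤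
        ∫⁻ U, ENNReal.ofReal (ρK U)
          ∂(Measure.pi fun _ : Edge 3 L => haarProbability (Matrix.specialUnitaryGroup n ℂ)) := by
  have h := partition_lower_of_regularity hLf hM B10Eq6PartitionLower.continuous_devSU
    B10Eq6PartitionLower.devSU_mul_le (fun u => (B10Eq6PartitionLower.devSU_inv u).le)
    B10Eq6PartitionLower.devSU_one (κ := 1 / 2) (by norm_num) act_le_half_devSU_sq hε₁ mini hχ h5 hmin
  have hcard : Fintype.card (Edge 3 L) = 3 * L ^ 3 := by
    simp [Fintype.card_prod, Fintype.card_pi, ZMod.card, Finset.prod_const, Fintype.card_fin, mul_comm]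
  rwa [hcard] at h

/-- **Row B10.Eq6, lower half, `G = SU(N)`, BOTH inputs discharged** (χ_K = 1 on the (47) restrictions, (5)_K,
[7] Thm 1 (8) on (4), `Bε₁ < g_Kp(g_K)`): the same bound.
[cite: Balaban1985UV3, Thm 1 p.257, (5) p.256, (6) p.257, (47) p.267; Balaban1985Variational, Thm 1 (8) p.279] -/
theorem partition_lower_of_regularity47_specialUnitaryGroup {L M Lf : ℕ} [NeZero L] [NeZero Lf] (hLf : Lf = L * M)
    (hM : 0 < M) {ε₁ : ℝ} (hε₁ : 0 < ε₁) {B gK pg O1 : ℝ}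
    (mini : GaugeConfig 3 L (Matrix.specialUnitaryGroup n ℂ) → GaugeConfig 3 Lf (Matrix.specialUnitaryGroup n ℂ))
    {χ ρK : GaugeConfig 3 L (Matrix.specialUnitaryGroup n ℂ) → ℝ}
    (hχ47 : ∀ U, (∀ (x : WSite 3 Lf) (i j : Fin 3),
      devSU (plaquetteHolonomy (mini U) x i j) < gK * pg * ((M : ℝ)⁻¹) ^ 2) → χ U = 1)
    (hsmall : B * ε₁ < gK * pg)
    (h5 : ∀ U, χ U * Real.exp (-(gK⁻¹ ^ 2 *
        fineAction (M : ℝ)⁻¹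
          (fun u : Matrix.specialUnitaryGroup n ℂ => 1 - UnitaryModel.nReTr (u : Matrix n n ℂ)) (mini U)) -
          O1 * (L : ℝ) ^ 3) ≤ ρK U)
    (hmin : ∀ U ∈ plaqSmall (d := 3) (L := L) devSU ε₁,
      ∀ (x : WSite 3 Lf) (i j : Fin 3), devSU (plaquetteHolonomy (mini U) x i j) ≤ B * ε₁ * ((M : ℝ)⁻¹) ^ 2) :
    0 < haarProbability (Matrix.specialUnitaryGroup n ℂ) {u | devSU u < ε₁ / 4} ∧
      ENNReal.ofReal (Real.exp (-((O1 + (3 * (1 / 2) * (B * ε₁) ^ 2) * gK⁻¹ ^ 2) * (L : ℝ) ^ 3))) *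
          haarProbability (Matrix.specialUnitaryGroup n ℂ) {u | devSU u < ε₁ / 4} ^ (3 * L ^ 3) ≤
        ∫⁻ U, ENNReal.ofReal (ρK U)
          ∂(Measure.pi fun _ : Edge 3 L => haarProbability (Matrix.specialUnitaryGroup n ℂ)) :=
  partition_lower_of_regularity_specialUnitaryGroup hLf hM hε₁ mini
    (chi_eq_one_of_minimizer_regular hM mini hχ47 hmin hsmall) h5 hmin

end SemisimpleCase

end Literature.MathematicalPhysics.QuantumFieldTheory.Balaban1983to89.B10Eq5RegularAction

end
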